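import Summits.AtomisticToContinuum.Crystallization.Theorems.ChartedZeroExcessLayeredLatticeLiouvilleXB

/-!
# Zero-excess layered lattice Liouville — part XC (lens-2 g58, node «SBGlueA»): the SCALAR CORE of the SB-glue recursion (u6)

Critic row 1051 (ORDER OF RECORD for `stmt-AtomisticToContinuum-26636` after XA/XB): next leaf := (2) `SubWindowBudgetGlueBPG` via parts SBGlueA–D.
This part is SBGlueA = the recursion of part UQ (u6) as PURE REAL LEMMAS (no lattice objects):

* (u6) in square-root variables.  With `s_j := √ê_j` (root excess at the `j`-th scale of one centre) the recursion
  `ê_{j+2} ≤ a·(ê_{j+1} + ê_j) + b·ê_{j+1}² + f_j` becomes `s_{j+2} ≤ √a·(s_{j+1} + s_j) + √b·s_{j+1}² + √f_j`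
  (`sqrt_twoStep_of_sq_twoStep`).
* DRIFT SUMMATION WITH BOOTSTRAP (`sum_le_of_twoStep_recursion`): if `s_{j+2} ≤ α(s_{j+1} + s_j) + β s_{j+1}² + g_j` with `2α + α' ≤ 1/2` and the
  smallness `β · B ≤ α'` for `B := 2(s₀ + s₁ + Σ_{j<J} g_j)`, then EVERY partial sum `Σ_{i ≤ n} s_i ≤ B` (`n ≤ J`) — the quadratic term is absorbed
  scale by scale because the running sum (hence each `s_i`) stays below `B`.  This is the `Σ_j m_j ≲ Σ_j √ê_j = O(√η)` step of (u6), uniform in the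
  number of scales `J` (no `log R` loss): `B` does not depend on `J` except through the forcing sum.
* FORCING SUM (`geom_forcing_sum_le`): in root variables the (I4)-tail forcing is geometric, `g_j = √f_j = g₀·q^j` with `q = t⁻¹ > 1` (`r_j = r₀tʲ`,
  scales going DOWN; the squared forcing `f_j ∝ r_j⁻²` has ratio `t⁻²`), and sums to `≤ g₀·q^J/(q − 1)` — the
  `C/ρ₀` of (u6)'s `Σ_j √ê_j ≤ C√(Aη)(1 + C/ρ₀)`.
Parts SBGlueB–D (g59): B = transported-certificate bookkeeping ((LD)/(HC) at `(c₀/2, 2C₁, κ₀/2)`, (RC) floors while `C_R·Σm ≤ min(c₀, κ₀)/2` — the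
smallness `β·B ≤ α'` above is exactly where that enters), C = top-scale budget from `IsGlobalReg` at `D = 8R` + per-centre induction producing the
hypotheses `hrec`, D = `subWindowBudgetGlueBPG_holds` at the literals and XB's record example re-run with `hglueS` discharged.
-/

namespace Summit.AtomisticToContinuum.Crystallization.Theorems.ChartedZeroExcessLayeredLatticeLiouville

open Finset

noncomputable section SBGlueA

/-- `√(x + y) ≤ √x + √y` for `0 ≤ x, y`. (dedup gate: public twin Literature.NumberTheory.LFunctions.MRT2015.sqrt_add_le_sqrt_add_sqrt lives in an unrelated module; kept PRIVATE here) -/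
private theorem sqrt_add_le_sqrt_add_sqrt {x y : ℝ} (hx : 0 ≤ x) (hy : 0 ≤ y) :
    Real.sqrt (x + y) ≤ Real.sqrt x + Real.sqrt y := by
  have h : x + y ≤ (Real.sqrt x + Real.sqrt y) ^ 2 := by
    nlinarith [Real.sq_sqrt hx, Real.sq_sqrt hy, Real.sqrt_nonneg x, Real.sqrt_nonneg y]
  calc Real.sqrt (x + y) ≤ Real.sqrt ((Real.sqrt x + Real.sqrt y) ^ 2) := Real.sqrt_le_sqrt h
    _ = Real.sqrt x + Real.sqrt y := Real.sqrt_sq (by positivity)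

/-- ★ (u6) IN ROOT VARIABLES: the squared two-step recursion `e₂ ≤ a(e₁ + e₀) + b·e₁² + f` gives, for the roots,
`√e₂ ≤ √a(√e₁ + √e₀) + √b·e₁ + √f`. -/
theorem sqrt_twoStep_of_sq_twoStep {e₀ e₁ e₂ a b f : ℝ} (he₀ : 0 ≤ e₀) (he₁ : 0 ≤ e₁) (ha : 0 ≤ a) (hb : 0 ≤ b)
    (hf : 0 ≤ f) (h : e₂ ≤ a * (e₁ + e₀) + b * e₁ ^ 2 + f) :
    Real.sqrt e₂ ≤ Real.sqrt a * (Real.sqrt e₁ + Real.sqrt e₀) + Real.sqrt b * e₁ + Real.sqrt f := by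
  have h1 : Real.sqrt e₂ ≤ Real.sqrt (a * (e₁ + e₀) + b * e₁ ^ 2 + f) := Real.sqrt_le_sqrt h
  have h2 : Real.sqrt (a * (e₁ + e₀) + b * e₁ ^ 2 + f) ≤
      Real.sqrt (a * (e₁ + e₀) + b * e₁ ^ 2) + Real.sqrt f :=
    sqrt_add_le_sqrt_add_sqrt (by positivity) hf
  have h3 : Real.sqrt (a * (e₁ + e₀) + b * e₁ ^ 2) ≤ Real.sqrt (a * (e₁ + e₀)) + Real.sqrt (b * e₁ ^ 2) :=
    sqrt_add_le_sqrt_add_sqrt (by positivity) (by positivity)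
  have h4 : Real.sqrt (a * (e₁ + e₀)) ≤ Real.sqrt a * (Real.sqrt e₁ + Real.sqrt e₀) := by
    rw [Real.sqrt_mul ha]
    exact mul_le_mul_of_nonneg_left (sqrt_add_le_sqrt_add_sqrt he₁ he₀) (Real.sqrt_nonneg a)
  have h5 : Real.sqrt (b * e₁ ^ 2) = Real.sqrt b * e₁ := by
    rw [Real.sqrt_mul hb, Real.sqrt_sq he₁]
  linarith

/-- ★★ DRIFT SUMMATION WITH QUADRATIC BOOTSTRAP.  A nonnegative sequence with `s (j+2) ≤ α (s (j+1) + s j) + β (s (j+1))² + g j` for `j + 2 ≤ J`,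
`2α + α' ≤ 1/2`, and the smallness `β · B ≤ α'` where `B := 2 (s 0 + s 1 + Σ_{j<J} g j)`, has ALL partial sums `Σ_{i<n+1} s i ≤ B` (`n ≤ J`).
The bound is uniform in `J` (no logarithmic loss in the number of scales). -/
theorem sum_le_of_twoStep_recursion {s g : ℕ → ℝ} {α α' β : ℝ} (J : ℕ)
    (hs : ∀ j, 0 ≤ s j) (hg : ∀ j, 0 ≤ g j) (hα : 0 ≤ α) (hα' : 0 ≤ α') (hβ : 0 ≤ β)
    (hsum : 2 * α + α' ≤ 1 / 2)
    (hrec : ∀ j, j + 2 ≤ J → s (j + 2) ≤ α * (s (j + 1) + s j) + β * s (j + 1) ^ 2 + g j)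
    (hboot : β * (2 * (s 0 + s 1 + ∑ j ∈ range J, g j)) ≤ α') :
    ∀ n, n ≤ J → ∑ i ∈ range (n + 1), s i ≤ 2 * (s 0 + s 1 + ∑ j ∈ range J, g j) := by
  set G := ∑ j ∈ range J, g j with hG_def
  have hG : 0 ≤ G := sum_nonneg fun j _ => hg j
  have hs0 := hs 0
  have hs1 := hs 1
  -- the inductive step: from the bound on `Σ_{i<n+1}` to the bound on `Σ_{i<n+2}` (for `n + 1 ≤ J`)
  have key : ∀ n, n + 1 ≤ J → ∑ i ∈ range (n + 1), s i ≤ 2 * (s 0 + s 1 + G) →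
      ∑ i ∈ range (n + 2), s i ≤ 2 * (s 0 + s 1 + G) := by
    intro n hn IH
    have hsB : ∀ i, i ≤ n → s i ≤ 2 * (s 0 + s 1 + G) := by
      intro i hi
      have h := single_le_sum (f := s) (fun k _ => hs k) (mem_range.2 (Nat.lt_succ_of_le hi))
      exact h.trans IH
    set T := ∑ i ∈ range (n + 2), s i with hT_def
    have hT0 : 0 ≤ T := sum_nonneg fun i _ => hs i
    -- split off the two bottom terms
    have hsplit : T = ∑ j ∈ range n, s (j + 2) + s 1 + s 0 := by
      rw [hT_def, sum_range_succ', sum_range_succ']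
    -- the three partial sums are ≤ T, the forcing partial sum ≤ G
    have hP0 : ∑ j ∈ range n, s j ≤ T := by
      rw [hT_def]
      exact sum_le_sum_of_subset_of_nonneg (fun i hi => mem_range.2 (lt_of_lt_of_le (mem_range.1 hi) (show n ≤ n + 2 by omega))) fun i _ _ => hs i
    have hP1 : ∑ j ∈ range n, s (j + 1) ≤ T := by
      have h1 : ∑ j ∈ range n, s (j + 1) ≤ ∑ j ∈ range (n + 1), s (j + 1) :=
        sum_le_sum_of_subset_of_nonneg (fun i hi => mem_range.2 (lt_of_lt_of_le (mem_range.1 hi) (show n ≤ n + 1 by omega))) fun i _ _ => hs (i + 1)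
      have h2 : T = ∑ j ∈ range (n + 1), s (j + 1) + s 0 := by rw [hT_def, sum_range_succ']
      linarith
    have hPg : ∑ j ∈ range n, g j ≤ G := by
      rw [hG_def]
      exact sum_le_sum_of_subset_of_nonneg (fun i hi => mem_range.2 (lt_of_lt_of_le (mem_range.1 hi) (show n ≤ J by omega))) fun i _ _ => hg i
    -- apply the recursion termwise, with the quadratic term bootstrapped: β s(j+1)² ≤ α' s(j+1)
    have hterm : ∀ j ∈ range n, s (j + 2) ≤ α * s (j + 1) + α * s j + α' * s (j + 1) + g j := by
      intro j hj
      have hjn : j < n := mem_range.1 hj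
      have hr := hrec j (by omega)
      have hb1 : β * s (j + 1) ≤ α' := by
        have := hsB (j + 1) (by omega)
        calc β * s (j + 1) ≤ β * (2 * (s 0 + s 1 + G)) := mul_le_mul_of_nonneg_left this hβ
          _ ≤ α' := hboot
      have hb2 : β * s (j + 1) ^ 2 ≤ α' * s (j + 1) := by
        have : β * s (j + 1) ^ 2 = (β * s (j + 1)) * s (j + 1) := by ring
        rw [this]
        exact mul_le_mul_of_nonneg_right hb1 (hs (j + 1))
      linarith
    have hS : ∑ j ∈ range n, s (j + 2) ≤
        ∑ j ∈ range n, (α * s (j + 1) + α * s j + α' * s (j + 1) + g j) := sum_le_sum hterm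
    have hexp : ∑ j ∈ range n, (α * s (j + 1) + α * s j + α' * s (j + 1) + g j) =
        α * ∑ j ∈ range n, s (j + 1) + α * ∑ j ∈ range n, s j + α' * ∑ j ∈ range n, s (j + 1) +
          ∑ j ∈ range n, g j := by
      simp only [sum_add_distrib, ← mul_sum]
    have hmain : T ≤ s 0 + s 1 + (2 * α + α') * T + G := by
      have h1 : α * ∑ j ∈ range n, s (j + 1) ≤ α * T := mul_le_mul_of_nonneg_left hP1 hα
      have h2 : α * ∑ j ∈ range n, s j ≤ α * T := mul_le_mul_of_nonneg_left hP0 hα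
      have h3 : α' * ∑ j ∈ range n, s (j + 1) ≤ α' * T := mul_le_mul_of_nonneg_left hP1 hα'
      nlinarith
    have hhalf : (2 * α + α') * T ≤ 1 / 2 * T := mul_le_mul_of_nonneg_right hsum hT0
    linarith
  -- induction on `n`
  intro n
  induction n with
  | zero =>
    intro _
    rw [sum_range_one]
    linarith
  | succ n ih =>
    intro hn
    exact key n hn (ih (by omega))

/-- ★ Corollary: each root excess and the full drift sum are bounded by `B`. -/
theorem terms_le_of_twoStep_recursion {s g : ℕ → ℝ} {α α' β : ℝ} (J : ℕ)
    (hs : ∀ j, 0 ≤ s j) (hg : ∀ j, 0 ≤ g j) (hα : 0 ≤ α) (hα' : 0 ≤ α') (hβ : 0 ≤ β)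
    (hsum : 2 * α + α' ≤ 1 / 2)
    (hrec : ∀ j, j + 2 ≤ J → s (j + 2) ≤ α * (s (j + 1) + s j) + β * s (j + 1) ^ 2 + g j)
    (hboot : β * (2 * (s 0 + s 1 + ∑ j ∈ range J, g j)) ≤ α') :
    (∀ i, i ≤ J → s i ≤ 2 * (s 0 + s 1 + ∑ j ∈ range J, g j)) ∧
      ∑ i ∈ range (J + 1), s i ≤ 2 * (s 0 + s 1 + ∑ j ∈ range J, g j) := by
  have h := sum_le_of_twoStep_recursion J hs hg hα hα' hβ hsum hrec hboot
  refine ⟨fun i hi => ?_, h J le_rfl⟩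
  have h1 := single_le_sum (f := s) (fun k _ => hs k) (mem_range.2 (Nat.lt_succ_of_le hi))
  exact h1.trans (h J le_rfl)

/-- ★ FORCING SUM: a geometric forcing `F·q^j` with ratio `q > 1` (scales going down; `q = t⁻¹` for the root forcing `g_j`) sums over `j < J` to at most
`F·q^J/(q − 1)` — the last (smallest) scale dominates: this is the `C/ρ₀` of (u6). -/
theorem geom_forcing_sum_le {F q : ℝ} (hF : 0 ≤ F) (hq : 1 < q) (J : ℕ) :
    ∑ j ∈ range J, F * q ^ j ≤ F * q ^ J / (q - 1) := by
  have hq1 : q - 1 ≠ 0 := by linarith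
  have hq0 : 0 < q - 1 := by linarith
  rw [← mul_sum, geom_sum_eq (by linarith : q ≠ 1) J, mul_div_assoc]
  apply mul_le_mul_of_nonneg_left _ hF
  apply div_le_div_of_nonneg_right _ hq0.le
  linarith [pow_pos (by linarith : (0:ℝ) < q) J]

/-- ★ The SMALLNESS in usable form: if the forcing is geometric, the bootstrap hypothesis `β·B ≤ α'` follows from a bound on the data at the TOP two scales
and on the LAST-scale forcing `F q^J/(q−1)` — the shape in which SBGlueB discharges it ((RC) floors: `C_R · Σ m ≤ min(c₀, κ₀)/2`). -/
theorem boot_of_geom_forcing {s : ℕ → ℝ} {α' β F q : ℝ} (J : ℕ) (hβ : 0 ≤ β) (hF : 0 ≤ F) (hq : 1 < q)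
    (h : β * (2 * (s 0 + s 1 + F * q ^ J / (q - 1))) ≤ α') :
    β * (2 * (s 0 + s 1 + ∑ j ∈ range J, F * q ^ j)) ≤ α' := by
  have hg := geom_forcing_sum_le hF hq J
  calc β * (2 * (s 0 + s 1 + ∑ j ∈ range J, F * q ^ j)) ≤ β * (2 * (s 0 + s 1 + F * q ^ J / (q - 1))) := by
        apply mul_le_mul_of_nonneg_left _ hβ
        linarith
    _ ≤ α' := h

/-- `SBGlueAShape`: record of the scalar core (for the successor's docket): root recursion, drift summation with bootstrap, forcing sum. -/
def SBGlueAShape : Prop :=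
  (∀ {e₀ e₁ e₂ a b f : ℝ}, 0 ≤ e₀ → 0 ≤ e₁ → 0 ≤ a → 0 ≤ b → 0 ≤ f → e₂ ≤ a * (e₁ + e₀) + b * e₁ ^ 2 + f →
      Real.sqrt e₂ ≤ Real.sqrt a * (Real.sqrt e₁ + Real.sqrt e₀) + Real.sqrt b * e₁ + Real.sqrt f) ∧
    (∀ (s g : ℕ → ℝ) (α α' β : ℝ) (J : ℕ), (∀ j, 0 ≤ s j) → (∀ j, 0 ≤ g j) → 0 ≤ α → 0 ≤ α' → 0 ≤ β →
      2 * α + α' ≤ 1 / 2 → (∀ j, j + 2 ≤ J → s (j + 2) ≤ α * (s (j + 1) + s j) + β * s (j + 1) ^ 2 + g j) →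
        β * (2 * (s 0 + s 1 + ∑ j ∈ range J, g j)) ≤ α' →
          ∑ i ∈ range (J + 1), s i ≤ 2 * (s 0 + s 1 + ∑ j ∈ range J, g j)) ∧
    (∀ (F q : ℝ) (J : ℕ), 0 ≤ F → 1 < q → ∑ j ∈ range J, F * q ^ j ≤ F * q ^ J / (q - 1))

/-- The shape record `SBGlueAShape` holds: packaged from `sqrt_twoStep_of_sq_twoStep`, `terms_le_of_twoStep_recursion`, `geom_forcing_sum_le`. [formal bookkeeping] -/
theorem sbGlueAShape_holds : SBGlueAShape :=
  ⟨fun he₀ he₁ ha hb hf h => sqrt_twoStep_of_sq_twoStep he₀ he₁ ha hb hf h,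
    fun s g _ _ _ J hs hg hα hα' hβ hsum hrec hboot =>
      (terms_le_of_twoStep_recursion (s := s) (g := g) J hs hg hα hα' hβ hsum hrec hboot).2,
    fun _ _ J hF hq => geom_forcing_sum_le hF hq J⟩

end SBGlueA

end Summit.AtomisticToContinuum.Crystallization.Theorems.ChartedZeroExcessLayeredLatticeLiouville
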